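import Literature.AnabelianGeometry.AbsoluteAnabelian.AbsAnabProp121viiCupCyclicClass
import Literature.NumberTheory.GaloisRepresentations.LocalCorInjective
import Literature.NumberTheory.GaloisRepresentations.LocalUnramifiedBrauer
import Literature.NumberTheory.GaloisRepresentations.CyclicLayerSurjective
import Literature.NumberTheory.GaloisRepresentations.TateUnramifiedLiftingReductionProofs
import HarnessLib

/-!
# [AbsAnab] Prop 1.2.1 (vii), sub-DAG row L06 — part 2: the normalised unramified character
# of an MLF (existence, uniqueness of its crossed homomorphism, and its cyclic classes)

Proof-only companion of `AbsAnabProp121viiSub.lean` (abc-iut cell, sub-DAG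
`plan/L4/SUBDAG-AbsAnab-Prop121vii.md`, statements holder abc-iut-w5-d198; row L06
`ExistsUniqueInvariantMap` held by abc-iut-w5-d201; second of three files, after
`AbsAnabProp121viiCupCyclicClass.lean`).  S. Mochizuki, *The Absolute Anabelian Geometry of
Hyperbolic Curves* (2004) [AbsAnab], Prop 1.2.1 (vii) p. 11 is pinned at level `n`
(`Prop121vii.IsInvariantMap`) through the class `κ_n(π) ∪ χ`, `χ` "the" normalised unramified
crossed homomorphism `G_K → μ_n^∨(1)` (`Prop121vii.IsNormalizedUnramifiedCocycle`: `σ ↦ (χ σ)·id`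
with `χ(I_K) = 0`, `χ(Frobenius lift) = 1`).  This file supplies the classical input about `χ`:

* `Prop121vii.normalizedUnramifiedCocycle_unique` — **uniqueness**: two normalised unramified
  crossed homomorphisms are equal (their difference is a continuous homomorphism with open kernel
  containing inertia and a Frobenius, trivial by Weil-group density,
  `IsNonarchimedeanLocalField.range_eq_zpowers_of_absInertia_le_ker`; Serre XIII §4).
* `Prop121vii.exists_normalizedCharacter` — **existence with the two class-field-theoretic
  properties**: for `n ≥ 2` a cyclic character `ψ : G_K ↠ ℤ/n` killing inertia with `ψ = 1` on
  every Frobenius lift (the character of the unramified extension `K_n/K`), such that the cyclic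
  class `κ_ψ(π) ∈ H²(G_K, K̄ˣ)` of a uniformiser has order divisible by `n` and `κ_ψ(v) = 0` for a
  unit `v` (Serre, *Local Fields* XIII §3 Prop. 6–7: `Br(K_n/K)` is cyclic of order `n` on the class
  of `π`, units are norms).  Obtained from the tree's layer formalism (`LocalUnramifiedBrauer`:
  `layerChar` at the class of an arithmetic Frobenius, `div_dvd_of_nsmul_cyclicClass_eq_zero`,
  `cyclicClass_eq_zero_of_dvd_tVal`) in the frame `E = ⊥` of
  `LocalCorInjective.exists_addOrderOf_eq_brauer`, with `f_⊥ = 1` read off the degree of the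
  arithmetic Frobenius in the Weil group, and transported to `G_K` along
  `Gal(K̄/K) = layerN L₁ D ∋` everything (`resH_twoCocycleClass`, `resHEquivOfTop`).
* `Prop121vii.isNormalizedUnramifiedCocycle_scalarCocycle` — `σ ↦ (ψ σ)·id` is then a normalised
  unramified cocycle.

HONEST FRAMING: classical local class field theory (Serre XIII–XIV) over the tree's continuous
cohomology; nothing here bears on [IUTchIII] Cor. 3.12.

## References
* [SerreLocalFields1979] J.-P. Serre, *Local Fields*, GTM 67 (1979), XIII §3 Prop. 6, Prop. 7,
  XIII §4 Prop. 13, XIV §1.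
* [MochizukiAbsAnab2004] S. Mochizuki, *The absolute anabelian geometry of hyperbolic curves* (2004),
  Prop 1.2.1 (vii) p. 11.
-/

noncomputable section

universe u

namespace Literature.AnabelianGeometry.AbsoluteAnabelian

open Field Function IntermediateField
open Literature.NumberTheory.GaloisRepresentations
open Literature.NumberTheory.GaloisRepresentations.DiscreteGaloisModule
open Literature.NumberTheory.GaloisRepresentations.LocalWeilDatum
open ValuativeRel

namespace Prop121vii

/-! ### §1. Normalised unramified cocycles are scalar, and unique (Weil-group density) -/

section Unique

variable (K : Type u) [Field K] [ValuativeRel K] [TopologicalSpace K] [IsNonarchimedeanLocalField K]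
  {n : ℕ} [Finite (MuCarrier K n)]

omit [ValuativeRel K] [TopologicalSpace K] [IsNonarchimedeanLocalField K] in
/-- A crossed homomorphism with `g σ m = (χ σ)·m` takes the value `scalarEnd (χ σ)` at `σ`.
[cite: SerreLocalFields1979, XIV §1] -/
theorem apply_eq_scalarEnd {g : contOneCocycles ((mu K n).tateDual n).toTopRep}
    {χ : absoluteGaloisGroup K → ZMod n}
    (hχ : ∀ (σ : absoluteGaloisGroup K) (m : MuCarrier K n),
      g.1 σ m = ((χ σ).val : ℤ) • MuCarrier.toAdditive m)
    (σ : absoluteGaloisGroup K) : g.1 σ = scalarEnd K (χ σ) :=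
  TateDual.ext fun m => by rw [hχ, scalarEnd_apply]

/-- **Uniqueness of the normalised unramified crossed homomorphism** (`G_K/I_K ≅ ℤ̂` is
topologically generated by Frobenius): two crossed homomorphisms `G_K → μ_n^∨(1)` of the form
`σ ↦ (χ σ)·id` with `χ` killing inertia and `χ = 1` on arithmetic Frobenius lifts are EQUAL — their
difference is a continuous homomorphism with open kernel containing `I_K` and a Frobenius, hence
trivial by the density of the Weil group (`range_eq_zpowers_of_absInertia_le_ker`).
[cite: SerreLocalFields1979, XIII §4 Prop. 13] -/
theorem normalizedUnramifiedCocycle_unique {g g' : contOneCocycles ((mu K n).tateDual n).toTopRep}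
    (hg : IsNormalizedUnramifiedCocycle K n g) (hg' : IsNormalizedUnramifiedCocycle K n g') :
    g = g' := by
  obtain ⟨χ, hχ, hI, hF⟩ := hg
  obtain ⟨χ', hχ', hI', hF'⟩ := hg'
  have e1 : ∀ σ, g.1 σ = scalarEnd K (χ σ) := apply_eq_scalarEnd K hχ
  have e2 : ∀ σ, g'.1 σ = scalarEnd K (χ' σ) := apply_eq_scalarEnd K hχ'
  -- the difference homomorphism `d : G_K → μ_n^∨(1)` (additive, written multiplicatively)
  let d : absoluteGaloisGroup K →* Multiplicative (TateDual K (MuCarrier K n) n) :=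
    { toFun := fun σ => Multiplicative.ofAdd (g.1 σ - g'.1 σ)
      map_one' := by rw [contOneCocycles.apply_one, contOneCocycles.apply_one, sub_self]; rfl
      map_mul' := fun σ τ => by
        rw [← ofAdd_add]
        congr 1
        rw [g.2 σ τ, g'.2 σ τ, ContinuousRep.toTopRep_ρ_apply, ContinuousRep.toTopRep_ρ_apply,
          e1 τ, e2 τ, tateDual_scalarEnd, tateDual_scalarEnd]
        abel }
  have hd : ∀ σ, d σ = Multiplicative.ofAdd (g.1 σ - g'.1 σ) := fun σ => rfl
  -- its kernel is open: the coincidence set of two continuous maps into a discrete space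
  have hker : (d.ker : Set (absoluteGaloisGroup K)) = (fun σ => g.1 σ - g'.1 σ) ⁻¹' {0} := by
    ext σ
    simp only [SetLike.mem_coe, MonoidHom.mem_ker, Set.mem_preimage, Set.mem_singleton_iff, hd]
    exact ⟨fun h => Multiplicative.ofAdd.injective (h.trans ofAdd_zero.symm),
      fun h => by rw [h, ofAdd_zero]⟩
  have hopen : IsOpen ((d.ker : Subgroup _) : Set (absoluteGaloisGroup K)) := by
    rw [hker]
    exact (isOpen_discrete _).preimage (g.1.continuous.sub g'.1.continuous)
  -- it contains inertia
  have hIker : absInertia K ≤ d.ker := fun σ hσ => by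
    rw [MonoidHom.mem_ker, hd, e1, e2, hI σ hσ, hI' σ hσ, sub_self, ofAdd_zero]
  -- and an arithmetic Frobenius
  obtain ⟨φ, hφ⟩ := exists_isAbsArithFrob_holds K
  have hφ1 : IsFrobPow φ 1 := IsAbsArithFrob.isFrobPow_holds hφ
  have hdφ : d φ = 1 := by
    rw [hd, e1, e2, hF φ hφ1, hF' φ hφ1, sub_self, ofAdd_zero]
  have hrange := IsNonarchimedeanLocalField.range_eq_zpowers_of_absInertia_le_ker d hopen hIker hφ
  rw [hdφ, Subgroup.zpowers_one_eq_bot] at hrange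
  -- so `d` is trivial
  refine Subtype.ext (ContinuousMap.ext fun σ => ?_)
  have hσ : d σ ∈ d.range := ⟨σ, rfl⟩
  rw [hrange, Subgroup.mem_bot, hd] at hσ
  exact sub_eq_zero.1 (Multiplicative.ofAdd.injective (hσ.trans ofAdd_zero.symm))

/-- The crossed homomorphism `scalarCocycle ψ` of an unramified cyclic character normalised at
Frobenius is a normalised unramified cocycle in the sense of `IsNormalizedUnramifiedCocycle`.
[cite: SerreLocalFields1979, XIV §1] -/
theorem isNormalizedUnramifiedCocycle_scalarCocycle [NeZero n]
    (ψ : CyclicCharacter (absoluteGaloisGroup K) n)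
    (hI : ∀ σ ∈ absInertia K, ψ σ = 0) (hF : ∀ σ : absoluteGaloisGroup K, IsFrobPow σ 1 → ψ σ = 1) :
    IsNormalizedUnramifiedCocycle K n (scalarCocycle ψ) :=
  ⟨ψ, fun σ m => scalarCocycle_apply ψ σ m, hI, hF⟩

end Unique


/-! ### §2. The normalised unramified character of an MLF and its cyclic classes -/

section Frame

variable (K : Type u) [Field K] [ValuativeRel K] [TopologicalSpace K] [IsNonarchimedeanLocalField K]
  [CharZero K]

/-- **The normalised unramified character of an MLF and its two class-field-theoretic properties.**
For an MLF `K` (characteristic `0`) and `n ≥ 2` there is a cyclic character `ψ : G_K ↠ ℤ/n` —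
the character of the unramified extension `K_n/K` of degree `n` sending the (any) arithmetic
Frobenius to `1` — which kills the inertia group, takes the value `1` on every Frobenius lift, and
whose cyclic classes `κ_ψ(u) = [c_ψ ⊗ u] ∈ H²(G_K, K̄ˣ)` satisfy: (a) `κ_ψ(π)` has order divisible by
`n` for a uniformiser `π` (Serre XIII §3 Prop. 7: `Br(K_n/K)` is cyclic of order `n` generated by the
class of `(K_n/K, Frob, π)`); (b) `κ_ψ(v) = 0` for a unit `v` (units are norms from the unramified
extension, Serre V §2, XIII §3 Prop. 6).  Obtained from the tree's layer formalism
(`LocalUnramifiedBrauer.lean`: `layerChar`, `div_dvd_of_nsmul_cyclicClass_eq_zero`,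
`cyclicClass_eq_zero_of_dvd_tVal`) in the frame `E = ⊥` of `LocalCorInjective.exists_addOrderOf_eq_brauer`,
transported to `G_K` along `Gal(K̄/K) = layerN L₁ D ∋` every element (`resH`, `resHEquivOfTop`).
[cite: SerreLocalFields1979, XIII §3 Prop. 6, Prop. 7] -/
theorem exists_normalizedCharacter (n : ℕ) (hn1 : 1 < n) :
    ∃ ψ : CyclicCharacter (absoluteGaloisGroup K) n,
      (∀ σ ∈ absInertia K, ψ σ = 0) ∧ (∀ σ : absoluteGaloisGroup K, IsFrobPow σ 1 → ψ σ = 1) ∧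
      (∀ (π : K), (valuation K).IsUniformizer π → ∀ u : (units K).toTopRep.ρ.invariants,
        (unitsVal K (u : UnitsCarrier K) : AlgebraicClosure K) = algebraMap K (AlgebraicClosure K) π →
        haveI : NeZero n := ⟨by omega⟩
        haveI : CompactSpace (absoluteGaloisGroup K) := absoluteGaloisGroup_compactSpace K
        ∀ j : ℕ, j • cyclicClass ψ (units K) u = 0 → n ∣ j) ∧
      (∀ (x : K), x ≠ 0 → valuation K x = 1 → ∀ u : (units K).toTopRep.ρ.invariants,
        (unitsVal K (u : UnitsCarrier K) : AlgebraicClosure K) = algebraMap K (AlgebraicClosure K) x →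
        haveI : NeZero n := ⟨by omega⟩
        haveI : CompactSpace (absoluteGaloisGroup K) := absoluteGaloisGroup_compactSpace K
        cyclicClass ψ (units K) u = 0) := by
  classical
  haveI : NeZero n := ⟨by omega⟩
  haveI : Fact (1 < n) := ⟨hn1⟩
  haveI : CompactSpace (absoluteGaloisGroup K) := absoluteGaloisGroup_compactSpace K
  have hn0 : 0 < n := by omega
  -- an arithmetic Frobenius
  obtain ⟨φ, hφ⟩ := exists_isAbsArithFrob_holds K
  have hφ1 : IsFrobPow φ 1 := IsAbsArithFrob.isFrobPow_holds hφ
  -- the frame `E = ⊥`: `L₁ = L₀ F_n ⊇ F_n` finite Galois, `D = Gal(L₁/K)`-image of `Gal(K̄/K)`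
  set E : IntermediateField K (AlgebraicClosure K) := ⊥ with hEdef
  obtain ⟨L₀, hfin, hgal, -⟩ := exists_finiteDimensional_isGalois_galFixing_subset (k := K)
    ((isOpen_galFixing K E).mem_nhds (galFixing K E).one_mem)
  haveI := hfin
  haveI := hgal
  haveI := (unramifiedLevel_finite_abelian_unramified K hn0).1
  haveI := (unramifiedLevel_finite_abelian_unramified K hn0).2.1
  let L₁ : IntermediateField K (AlgebraicClosure K) := L₀ ⊔ unramifiedLevel K n
  haveI : FiniteDimensional K L₁ := IntermediateField.finiteDimensional_sup L₀ _
  haveI : IsGalois K L₁ := isGalois_iff.2 ⟨inferInstance, inferInstance⟩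
  have hnL : unramifiedLevel K n ≤ L₁ := le_sup_right
  let D : Subgroup (L₁ ≃ₐ[K] L₁) := (galFixing K E).map (resGal L₁)
  haveI : CompactSpace (layerN L₁ D) := compactSpace_of_isClosed_subgroup (hS := isClosed_layerN L₁ D)
  -- a `G_K`-invariant of `K̄ˣ` as an invariant of the layer representation `K̄ˣ|_{layerN L₁ D}`
  let invR : (units K).toTopRep.ρ.invariants → (layerRep L₁ D).toTopRep.ρ.invariants :=
    fun u => ⟨(u : UnitsCarrier K), fun s => u.2 (s : absoluteGaloisGroup K)⟩
  have hEtop : galFixing K E = ⊤ := by rw [hEdef, galFixing_bot]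
  have hDE : layerN L₁ D = galFixing K E := by
    change ((galFixing K E).map (resGal L₁)).comap (resGal L₁) = galFixing K E
    rw [Subgroup.comap_map_eq_self]
    rw [ker_resGal, hEtop]
    exact le_top
  have hS : ∀ g : absoluteGaloisGroup K, g ∈ layerN L₁ D := fun g => by
    rw [hDE, hEtop]; trivial
  have hfield : fieldOf K L₁ D = E := by
    apply eq_of_galFixing_eq K
    rw [← layerN_eq_galFixing, hDE]
  -- `f_⊥ = 1`: the residue degree divides the degree `1` of the arithmetic Frobenius
  have hf : fDeg K (fieldOf K L₁ D) = 1 := by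
    rw [hfield]
    have hw : WeilGroup.mk φ ⟨1, hφ1⟩ ∈ fieldSubgroup K E := by
      rw [hEdef, fieldSubgroup_bot]; trivial
    have h := fDeg_dvd_degZ K E hw
    have hdeg : WeilGroup.deg (WeilGroup.mk φ ⟨1, hφ1⟩) = 1 :=
      (WeilGroup.deg_eq_iff IsFrobPow.mul_holds IsFrobPow.unique_holds).2 (by simpa using hφ1)
    rw [degZ_degHom, hdeg] at h
    have h' : fDeg K E ∣ 1 := by exact_mod_cast h
    exact Nat.dvd_one.1 h'
  have hfm : fDeg K (fieldOf K L₁ D) ∣ n := by rw [hf]; exact one_dvd n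
  -- the unramified layer `D_n` and the cyclic quotient of order `n`
  have hDL : unrLayer K L₁ D n ≤ D := unrLayer_le K L₁ D n
  have hnrm : ((unrLayer K L₁ D n).subgroupOf D).Normal := normal_unrLayer K L₁ D hn0
  haveI := normal_layerN'_subgroupOf L₁ hDL hnrm
  have hcard : Nat.card (layerN L₁ D ⧸ layerS L₁ D (unrLayer K L₁ D n)) = n := by
    have h := natCard_quot_unrLayer K L₁ D hn0 hnL hfm
    rwa [hf, Nat.div_one] at h
  haveI : Finite (layerN L₁ D ⧸ layerS L₁ D (unrLayer K L₁ D n)) :=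
    Nat.finite_of_card_ne_zero (by rw [hcard]; exact NeZero.ne n)
  -- membership in the layer subgroup = fixing the unramified level `F_n`
  have hmemS : ∀ σ : layerN L₁ D, σ ∈ layerS L₁ D (unrLayer K L₁ D n) ↔
      ∀ x ∈ unramifiedLevel K n, (σ : absoluteGaloisGroup K) • x = x := by
    intro σ
    rw [Subgroup.mem_subgroupOf]
    change (σ : absoluteGaloisGroup K) ∈ layerN L₁ (unrLayer K L₁ D n) ↔ _
    rw [layerN_unrLayer K L₁ D hnL, hfield, mem_galFixing_iff, unrLevel, hEdef, bot_sup_eq]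
  -- the class `s` of the Frobenius generates the quotient
  set φ' : layerN L₁ D := ⟨φ, hS φ⟩ with hφ'def
  set s : layerN L₁ D ⧸ layerS L₁ D (unrLayer K L₁ D n) :=
    (↑φ' : layerN L₁ D ⧸ layerS L₁ D (unrLayer K L₁ D n)) with hsdef
  have hpow : ∀ j : ℕ, s ^ j = 1 ↔ n ∣ j := by
    intro j
    rw [hsdef, ← QuotientGroup.mk_pow, QuotientGroup.eq_one_iff, hmemS,
      forall_smul_eq_self_unramifiedLevel_iff]
    have hσ : IsFrobPow (((φ' ^ j : layerN L₁ D) : absoluteGaloisGroup K)) (j : ℤ) := by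
      rw [Subgroup.coe_pow]
      simpa using hφ1.pow j
    exact smul_eq_self_iff_dvd_of_isFrobPow K hn0 (isPrimitiveRoot_rootOfUnramifiedLevel K hn0) hσ
  have horder : orderOf s = n := by
    rw [orderOf_eq_iff hn0]
    refine ⟨(hpow n).2 dvd_rfl, fun m hm hm0 h => ?_⟩
    exact absurd (Nat.le_of_dvd hm0 ((hpow m).1 h)) (not_le.2 hm)
  have hs : ∀ x, x ∈ Subgroup.zpowers s := by
    have htop : Subgroup.zpowers s = ⊤ := by
      apply Subgroup.eq_top_of_card_eq
      rw [Nat.card_zpowers, horder, hcard]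
    intro x
    rw [htop]
    exact Subgroup.mem_top x
  have hSopen : IsOpen ((layerS L₁ D (unrLayer K L₁ D n) : Subgroup (layerN L₁ D)) :
      Set (layerN L₁ D)) :=
    isOpen_layerN'_subgroupOf L₁ D _
  -- the layer character normalised at Frobenius, and its transport to `G_K`
  let θ : CyclicCharacter (layerN L₁ D) n := layerChar L₁ s hs hcard hSopen
  have hθker : θ.ker = layerS L₁ D (unrLayer K L₁ D n) := ker_layerChar L₁ s hs hcard hSopen
  have hθφ : θ φ' = 1 := layerChar_eq_one L₁ s hs hcard hSopen rfl
  let ψ : CyclicCharacter (absoluteGaloisGroup K) n :=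
    { toFun := fun σ => θ ⟨σ, hS σ⟩
      map_mul' := fun σ τ => θ.map_mul ⟨σ, hS σ⟩ ⟨τ, hS τ⟩
      continuous_toFun := θ.continuous.comp (toTopSubgroup (layerN L₁ D) hS).continuous
      surjective' := fun i => by
        obtain ⟨σ, hσ⟩ := θ.surjective' i
        exact ⟨σ, hσ⟩ }
  have hψ : ∀ σ : absoluteGaloisGroup K, ψ σ = θ ⟨σ, hS σ⟩ := fun σ => rfl
  -- inertia is killed: it fixes the unramified level
  have hψI : ∀ σ ∈ absInertia K, ψ σ = 0 := by
    intro σ hσ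
    rw [hψ, ← CyclicCharacter.mem_ker, hθker, hmemS]
    intro x hx
    exact (unramifiedLevel_finite_abelian_unramified K hn0).2.2 σ hσ ⟨x, hx⟩
  -- every Frobenius lift has character `1`
  have hψF : ∀ σ : absoluteGaloisGroup K, IsFrobPow σ 1 → ψ σ = 1 := by
    intro σ hσ
    have hι : σ * φ⁻¹ ∈ absInertia K := IsFrobPow.mul_inv_mem_absInertia_holds hσ hφ1
    have h1 : ψ (σ * φ⁻¹ * φ) = ψ (σ * φ⁻¹) + ψ φ := ψ.map_mul _ _
    rw [inv_mul_cancel_right, hψI _ hι, zero_add] at h1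
    rw [h1, hψ]
    exact hθφ
  -- transport of cyclic classes along `res : H²(G_K, K̄ˣ) → H²(layerN L₁ D, K̄ˣ)`
  have htrans : ∀ u : (units K).toTopRep.ρ.invariants,
      resH (layerN L₁ D) (units K) 2 (cyclicClass ψ (units K) u) =
        cyclicClass θ (layerRep L₁ D) (invR u) := by
    intro u
    rw [cyclicClass_apply, cyclicClass_apply, resH_twoCocycleClass]
    exact congrArg _ (Subtype.ext (ContinuousMap.ext fun q => by
      obtain ⟨σ, τ⟩ := q
      rfl))
  -- `t`-values in the frame: `t_⊥(x) = ord_K(x)`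
  have hfinrank : Module.finrank K (fieldOf K L₁ D) = 1 := by rw [hfield, hEdef, IntermediateField.finrank_bot]
  have htval : ∀ (x : K) (u : (units K).toTopRep.ρ.invariants),
      (unitsVal K (u : UnitsCarrier K) : AlgebraicClosure K) = algebraMap K (AlgebraicClosure K) x →
      tVal K (fieldOf K L₁ D) (kUnit K L₁ D (invR u) : fieldOf K L₁ D) =
        LocalWeilDatum.ord K x := by
    intro x u hu
    have hk : (kUnit K L₁ D (invR u) : fieldOf K L₁ D) =
        algebraMap K (fieldOf K L₁ D) x := by
      apply Subtype.ext
      rw [coe_kUnit]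
      exact hu
    rw [tVal, hk, Algebra.norm_algebraMap, hfinrank, pow_one]
  refine ⟨ψ, hψI, hψF, ?_, ?_⟩
  · -- (a) the class of a uniformiser has order divisible by `n`
    intro π hπ u hu j hj
    have hπ0 : π ≠ 0 := hπ.ne_zero
    have hta : tVal K (fieldOf K L₁ D) (kUnit K L₁ D (invR u) :
        fieldOf K L₁ D) = fDeg K (fieldOf K L₁ D) := by
      rw [htval π u hu, hf, Nat.cast_one]
      exact (ord_eq_one_iff K hπ0).2 hπ
    have hj' : j • cyclicClass θ (layerRep L₁ D) (invR u) = 0 := by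
      rw [← htrans, ← map_nsmul, hj, map_zero]
    have h := div_dvd_of_nsmul_cyclicClass_eq_zero K L₁ hn0 hnL hfm θ hθker _ hta hj'
    rwa [hf, Nat.div_one] at h
  · -- (b) the class of a unit vanishes
    intro x hx0 hx u hu
    have ha : ((n : ℕ) : ℤ) ∣ tVal K (fieldOf K L₁ D)
        (kUnit K L₁ D (invR u) : fieldOf K L₁ D) := by
      rw [htval x u hu, (ord_eq_zero_iff K hx0).2 hx]
      exact dvd_zero _
    have h0 : cyclicClass θ (layerRep L₁ D) (invR u) = 0 :=
      cyclicClass_eq_zero_of_dvd_tVal K L₁ hn0 hnL hfm θ hθker _ ha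
    have h1 : resH (layerN L₁ D) (units K) 2 (cyclicClass ψ (units K) u) = 0 := by
      rw [htrans, h0]
    have h2 : resHEquivOfTop (units K) (layerN L₁ D) hS 2 (cyclicClass ψ (units K) u) = 0 := by
      rw [resHEquivOfTop_apply]; exact h1
    exact (map_eq_zero_iff _ (resHEquivOfTop (units K) (layerN L₁ D) hS 2).injective).1 h2

end Frame

end Prop121vii

end Literature.AnabelianGeometry.AbsoluteAnabelian

end
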